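import Mathlib
import Summits.KontsevichZagierPeriods.Zeta5Search.BrickLucasAssembly

/-!
# BrickStripFactor — the strip derivative `w₁(k)` of a ° cell through the digit-stripping factorisation:
`w₁ = a·([X¹]E_k + E_k(0)·[X¹]U)`, hence `v(w₁) ≥ max(m,1)` and `w₁ ≡ a·[X¹]E_k (mod p^{m+1})` (cell zeta5-irr)

HONEST FRAMING: systematic search; no irrationality claim unless certified. INSTRUMENT-tier arithmetic of the ζ(5)
census cell zeta5-irr (HOME `run/shared/lean/pub/zeta5-irr/`), filed by the engine seat zi-eng (g13). WHAT THIS IS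
NOT: nothing about ζ(5); no denominator saving; 0 nats/n; rung F-Z1 NOT moved. Plumbing for the strip-sum law (V) of
`BrickLucasAssembly.lucas_of_blockLaws`.

## The statements (`p` odd, `2B ≤ A`, row `n = n₀ + Np`, ° cell `k = k₀ + Kp`, `k₀ ≤ n₀ < p`, `K ≤ N`, off the exact
centre; `m = B c_a + B c_b + ε c_c` the number of paid members, `E_k = carryPoly` the boundary polynomial,
`λ_k = c_{k,A}(n)/c̃_{K,A}(N)`, `w₁(k) = BrickLucasAssembly.stripDeriv`)

From `BrickDigitStripCirc.laurent_rescale_eq_sum_circ` (`p^d[T^d]F_k = a·Σ_{e+g=d}[T^e]F̃_K·[T^g](E_k U)`, `U(0) = 1`,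
`[T^g]U ∈ p^gℤ_(p)`, `a·E_k(0) = λ_k`, `v(a) = m` by `BrickLambdaCirc.padicValuation_stripConst`) at `d = 1`:
* `stripDeriv_eq` (packaged as `strip_factor`): `w₁(k) = a·([X¹]E_k + E_k(0)·[T¹]U)`;
* `padicValuation_stripDeriv_le_one`: `v(w₁(k)) ≤ exp(−1)`; `padicValuation_stripDeriv_le`: `v(w₁(k)) ≤ exp(−m)`;
* `padicValuation_stripDeriv_sub_le`: `v(w₁(k) − (λ_k/E_k(0))·[X¹]E_k) ≤ exp(−(m+1))`.
-/

namespace Summit.KontsevichZagierPeriods.Zeta5Search.BrickStripFactor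

open Finset Nat Polynomial WithZero
open Summit.KontsevichZagierPeriods.Zeta5Search.BrickTopCoefficient (cTop)
open Summit.KontsevichZagierPeriods.Zeta5Search.BrickLaurent (laurent laurent_zero)
open Summit.KontsevichZagierPeriods.Zeta5Search.ScaledSeries (IsSlopeInt)
open Summit.KontsevichZagierPeriods.Zeta5Search.BrickDigitStripCirc (carryPoly centreCarry laurent_rescale_eq_sum_circ
  carryPoly_eval_zero_ne_zero)
open Summit.KontsevichZagierPeriods.Zeta5Search.BrickLambda (cTop_zero_ne_zero)
open Summit.KontsevichZagierPeriods.Zeta5Search.BrickLambdaCirc (padicValuation_stripConst)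
open Summit.KontsevichZagierPeriods.Zeta5Search.BrickResidueLawCirc (natDegree_carryPoly_le
  padicValuation_coeff_carryPoly_le)
open Summit.KontsevichZagierPeriods.Zeta5Search.BrickLucasAssembly (stripDeriv)

noncomputable section

variable {p : ℕ} [Fact p.Prime]

section factor

variable (hp2 : p ≠ 2) {A B ε N n₀ K k₀ : ℕ} (hAB : 2 * B ≤ A) (hn₀ : n₀ < p) (hk₀ : k₀ ≤ n₀) (hK : K ≤ N)
  (hcen : 2 * (k₀ + K * p) ≠ n₀ + N * p ∨ ε = 0)
include hp2 hAB hn₀ hk₀ hK hcen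

/-- **The strip derivative through the factorisation**: there are the constant `a` of (★) (`v(a) = exp(−m)`,
`a·E_k(0) = λ_k`) and the unit series `U` (`U(0) = 1`, `[T^g]U ∈ p^gℤ_(p)`) with `w₁(k) = a·([X¹]E_k + E_k(0)·[T¹]U)`. -/
theorem strip_factor :
    ∃ U : PowerSeries ℚ, PowerSeries.constantCoeff U = 1 ∧ IsSlopeInt p (-1) 0 U ∧ ∃ a : ℚ,
      Rat.padicValuation p a = exp (-((B * ((n₀ + k₀) / p) + B * ((n₀ + (n₀ - k₀)) / p) +
        ε * centreCarry p (n₀ + N * p) (k₀ + K * p) : ℕ) : ℤ)) ∧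
      a * (carryPoly p B ε N n₀ K k₀).eval 0 = cTop A B ε (n₀ + N * p) (k₀ + K * p) / cTop A B 0 N K ∧
      stripDeriv A B ε p n₀ N k₀ K =
        a * ((carryPoly p B ε N n₀ K k₀).coeff 1 + (carryPoly p B ε N n₀ K k₀).eval 0 * PowerSeries.coeff 1 U) := by
  have hkn : k₀ + K * p ≤ n₀ + N * p := by nlinarith
  obtain ⟨U, hU0, hUint, a, hsum, hlam⟩ :=
    laurent_rescale_eq_sum_circ (p := p) hp2 (A := A) (B := B) (ε := ε) hn₀ hk₀ hK rfl rfl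
  have hva := padicValuation_stripConst (p := p) hp2 hn₀ hk₀ hK hAB rfl rfl hcen hlam
  set E : ℚ[X] := carryPoly p B ε N n₀ K k₀ with hE
  have h0 := cTop_zero_ne_zero hK A B
  rw [laurent_zero hAB 0 hK, laurent_zero hAB ε hkn] at hlam
  refine ⟨U, hU0, hUint, a, hva, by rw [← hlam, mul_div_cancel_right₀ _ h0], ?_⟩
  have h1 := hsum 1
  rw [Finset.Nat.sum_antidiagonal_succ, Finset.Nat.antidiagonal_zero, Finset.sum_singleton, laurent_zero hAB 0 hK,
    pow_one] at h1
  simp only [zero_add] at h1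
  -- `h1 : p·laurent ε n k 1 = a·(cTop 0 N K·[T¹](EU) + laurent 0 N K 1·[T⁰](EU))`
  have hEU0 : PowerSeries.coeff 0 ((E : PowerSeries ℚ) * U) = E.eval 0 := by
    rw [PowerSeries.coeff_zero_eq_constantCoeff_apply, map_mul, hU0, mul_one, Polynomial.constantCoeff_coe,
      coeff_zero_eq_eval_zero]
  have hEU1 : PowerSeries.coeff 1 ((E : PowerSeries ℚ) * U) = E.coeff 1 + E.eval 0 * PowerSeries.coeff 1 U := by
    rw [PowerSeries.coeff_mul, Finset.Nat.sum_antidiagonal_succ, Finset.Nat.antidiagonal_zero, Finset.sum_singleton]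
    simp only [zero_add, Polynomial.coeff_coe, PowerSeries.coeff_zero_eq_constantCoeff_apply, hU0, mul_one,
      coeff_zero_eq_eval_zero]
    ring
  rw [hEU0, hEU1] at h1
  rw [stripDeriv, ← hlam, div_eq_iff h0, mul_div_cancel_right₀ _ h0]
  linear_combination h1

/-- **`v(w₁(k)) ≤ exp(−1)`**: the strip derivative of a ° cell off the exact centre lies in `pℤ_(p)`. -/
theorem padicValuation_stripDeriv_le_one : Rat.padicValuation p (stripDeriv A B ε p n₀ N k₀ K) ≤ exp (-1 : ℤ) := by
  obtain ⟨U, hU0, hUint, a, hva, hlam, hw⟩ := strip_factor hp2 hAB hn₀ hk₀ hK hcen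
  set m : ℕ := B * ((n₀ + k₀) / p) + B * ((n₀ + (n₀ - k₀)) / p) + ε * centreCarry p (n₀ + N * p) (k₀ + K * p) with hm
  have hU1 : Rat.padicValuation p (PowerSeries.coeff 1 U) ≤ exp (-1 : ℤ) := by
    have h := hUint 1; rwa [Nat.cast_one, mul_one, add_zero] at h
  rw [hw, mul_add, ← mul_assoc]
  refine (Valuation.map_add _ _ _).trans (max_le ?_ ?_)
  · -- `a·[X¹]E`: zero in the main case, `∈ p^m ℤ_(p)` with `m ≥ 1` otherwise
    rw [map_mul]
    by_cases hm1 : 1 ≤ m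
    · calc _ ≤ exp (-(m : ℤ)) * 1 := mul_le_mul' hva.le (padicValuation_coeff_carryPoly_le hp2 B ε N n₀ K k₀ 1)
        _ ≤ _ := by rw [mul_one, exp_le_exp]; omega
    · rw [coeff_eq_zero_of_natDegree_lt ((natDegree_carryPoly_le (p := p) B ε N n₀ K k₀).trans_lt (by omega)),
        map_zero, mul_zero]
      exact _root_.zero_le
  · rw [map_mul, hlam]
    calc _ ≤ 1 * exp (-1 : ℤ) := mul_le_mul'
          (BrickResidueLawCirc.lambda_circ_le_one hp2 rfl rfl hn₀ hk₀ hK (div_mul_cancel₀ _ (cTop_zero_ne_zero hK A B)))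
          hU1
      _ = _ := one_mul _

/-- **`v(w₁(k)) ≤ exp(−m)`**: the strip derivative pays every gained member. -/
theorem padicValuation_stripDeriv_le :
    Rat.padicValuation p (stripDeriv A B ε p n₀ N k₀ K) ≤ exp (-((B * ((n₀ + k₀) / p) + B * ((n₀ + (n₀ - k₀)) / p) +
      ε * centreCarry p (n₀ + N * p) (k₀ + K * p) : ℕ) : ℤ)) := by
  obtain ⟨U, hU0, hUint, a, hva, hlam, hw⟩ := strip_factor hp2 hAB hn₀ hk₀ hK hcen
  have hU1 : Rat.padicValuation p (PowerSeries.coeff 1 U) ≤ 1 := by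
    have h := hUint 1; rw [Nat.cast_one, mul_one, add_zero] at h
    exact h.trans (by rw [← exp_zero, exp_le_exp]; norm_num)
  rw [hw, map_mul]
  calc _ ≤ _ * 1 := mul_le_mul' hva.le ((Valuation.map_add _ _ _).trans (max_le
        (padicValuation_coeff_carryPoly_le hp2 B ε N n₀ K k₀ 1) (by
          rw [map_mul, ← coeff_zero_eq_eval_zero]
          exact mul_le_one' (padicValuation_coeff_carryPoly_le hp2 B ε N n₀ K k₀ 0) hU1)))
    _ = _ := mul_one _

/-- **`w₁(k) ≡ (λ_k/E_k(0))·[X¹]E_k (mod p^{m+1})`**: `v(w₁(k) − (λ_k/E_k(0))·[X¹]E_k) ≤ exp(−(m+1))` — the unit-series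
part `a·E_k(0)·[T¹]U` pays one more `p`. -/
theorem padicValuation_stripDeriv_sub_le :
    Rat.padicValuation p (stripDeriv A B ε p n₀ N k₀ K -
      cTop A B ε (n₀ + N * p) (k₀ + K * p) / cTop A B 0 N K / (carryPoly p B ε N n₀ K k₀).eval 0 *
        (carryPoly p B ε N n₀ K k₀).coeff 1) ≤
      exp (-((B * ((n₀ + k₀) / p) + B * ((n₀ + (n₀ - k₀)) / p) + ε * centreCarry p (n₀ + N * p) (k₀ + K * p) : ℕ) : ℤ) - 1) := by
  obtain ⟨U, hU0, hUint, a, hva, hlam, hw⟩ := strip_factor hp2 hAB hn₀ hk₀ hK hcen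
  have hE0 : (carryPoly p B ε N n₀ K k₀).eval 0 ≠ 0 := carryPoly_eval_zero_ne_zero (p := p) hK hcen
  have hU1 : Rat.padicValuation p (PowerSeries.coeff 1 U) ≤ exp (-1 : ℤ) := by
    have h := hUint 1; rwa [Nat.cast_one, mul_one, add_zero] at h
  rw [← hlam, mul_div_cancel_right₀ _ hE0, hw, show a * ((carryPoly p B ε N n₀ K k₀).coeff 1 +
      (carryPoly p B ε N n₀ K k₀).eval 0 * PowerSeries.coeff 1 U) - a * (carryPoly p B ε N n₀ K k₀).coeff 1 =
      a * ((carryPoly p B ε N n₀ K k₀).eval 0 * PowerSeries.coeff 1 U) by ring, map_mul, map_mul,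
    ← coeff_zero_eq_eval_zero]
  calc _ ≤ _ * (1 * exp (-1 : ℤ)) :=
      mul_le_mul' hva.le (mul_le_mul' (padicValuation_coeff_carryPoly_le hp2 B ε N n₀ K k₀ 0) hU1)
    _ = _ := by rw [one_mul, ← exp_add]; rfl

end factor

end

end Summit.KontsevichZagierPeriods.Zeta5Search.BrickStripFactor
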